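import Summits.AtomisticToContinuum.Crystallization.Theorems.ThreeConeCertificateSlackRigidityPricedFloorsFaults
import Summits.AtomisticToContinuum.Crystallization.Theorems.ThreeConeCertificateSlackRigidityPricedFloorsFinal0
import Summits.AtomisticToContinuum.Crystallization.Theorems.ThreeConeCertificateSlackRigidityPricedFloorsKernels1
import Summits.AtomisticToContinuum.Crystallization.Theorems.ThreeConeCertificateSlackRigidityPricedFloorsUnique3
import Summits.AtomisticToContinuum.Crystallization.Theorems.ThreeConeCertificateSlackRigidityPricedFloorsFaultIdent1
import Summits.AtomisticToContinuum.Crystallization.Theorems.ThreeConeCertificateSlackRigidityPricedFloorsFaultIdent2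
import Summits.AtomisticToContinuum.Crystallization.Theorems.ThreeConeCertificateSlackRigidityPricedFloorsFaultIdent3
import Summits.AtomisticToContinuum.Crystallization.Theorems.ThreeConeCertificateSlackRigidityPricedFloorsFaultIdent4
import Summits.AtomisticToContinuum.Crystallization.Theorems.ThreeConeCertificateSlackRigidityPricedFloorsIncrIdent5
import Summits.AtomisticToContinuum.Crystallization.Theorems.ThreeConeCertificateSlackRigidityPricedFloorsWindowLower
import HarnessLib

/-!
# `SlackRigidity` (stmt-AtomisticToContinuum-11960), line `priced-floors-palm-exactification`, stub S3
# (`stub_layeredMeanSelection`): final assembly, part 1 — almost surely no stacking faults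

Lead c19, worker W16.  The mean fault-exclusion mechanism
`SlackRigidityPricedFloorsFaults.lms_faults_ae_zero` is instantiated with the landed ingredients:

* the measurable competitor-energy and fault functionals `Hc`, `F`, identified on fitted samples
  (`SlackRigidityPricedFloorsFaultIdent.lms_exists_fault_functionals`, through the data relation
  `SlackRigidityPricedFloorsUnique.lms_rel_of_fits`), priced by
  `SlackRigidityPricedFloorsFaultIdent.lms_fault_price_ae_form`;
* for every `n`, the uniform layer-transport kernels over the `2n+1` layers around the root
  (`SlackRigidityPricedFloorsKernels.lms_exists_kernels` with the uniform weight vector of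
  `lms_uniformCoeff_props`, rigidity off the fcc lattices
  `SlackRigidityPricedFloorsUnique.lms_layerRigid_of_not_fcc`), under which the transported competitor
  energy is pointwise at least `2e* − C/(2n+1)`: off the fcc lattices by the transport bound
  `SlackRigidityPricedFloorsFaultIdent.lms_fault_transport_bound` (fed with the window lower bound
  `SlackRigidityPricedFloorsWindowLower.stub_windowLowerBound`) evaluated on the re-rooted samples
  (`SlackRigidityPricedFloorsIncrIdent.lms_reroot_sample`), and on the fcc lattices (trivial transport)
  by `SlackRigidityPricedFloorsFaultIdent.lms_competitor_ge_of_fcc`.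

Hence the fault indicator vanishes at the root almost surely; by the root-to-everywhere transfer
`PalmUnimodularRigidity.ae_forall_map_sub_of_ae` it vanishes at every point of almost every sample,
i.e. the whole stacking word alternates: `s (m+1) = −s m` for all `m` (registered sub-goal
`lms_ae_faultfree`).  All `[folklore]`.
-/

noncomputable section

open MeasureTheory Filter Set
open scoped ENNReal BigOperators Topology

namespace Summit.AtomisticToContinuum.Crystallization.Theorems.SlackRigidityPricedFloorsFinal

open Literature.Probability.Process
open Literature.MathematicalPhysics.StatisticalMechanics
open Summit.AtomisticToContinuum.Crystallization.Theorems.SlackRigidityPricedFloors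
open Summit.AtomisticToContinuum.Crystallization.Theorems.SlackRigidityPricedFloorsFaults
open Summit.AtomisticToContinuum.Crystallization.Theorems.SlackRigidityPricedFloorsKernels
open Summit.AtomisticToContinuum.Crystallization.Theorems.SlackRigidityPricedFloorsUnique
open Summit.AtomisticToContinuum.Crystallization.Theorems.SlackRigidityPricedFloorsFaultIdent
open Summit.AtomisticToContinuum.Crystallization.Theorems.SlackRigidityPricedFloorsIncrIdent
open Summit.AtomisticToContinuum.Crystallization.Theorems.SlackRigidityPricedFloorsWindowLower
open Summit.AtomisticToContinuum.Crystallization.Theorems.SlackRigidityPricedFloorsStationarity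
  (lintegral_count_restrict_congr)
open Summit.AtomisticToContinuum.Crystallization.Theorems.MinimiserShells.Negative.LoadBearing (eStar)

/-! ## Step 1: the fault indicator vanishes at the root almost surely -/

/-- **The fault functional vanishes almost surely.**  For the measurable functionals `Hc`, `F` of
`lms_exists_fault_functionals` (any pair that is bounded and identified with the competitor energy
`HcE e` and the fault indicator `faultE e` on fitted rooted `δ`-separated samples), under a minimising
law almost surely carried by globally layered samples, `F = 0` almost surely. [folklore] -/
theorem faults_ae_zero_of_ident {δ : ℝ} (hδ : 0 < δ) {P : Measure (Measure E3)}
    [hP : IsProbabilityMeasure P] (hlaw : IsMinimisingLaw δ P)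
    (hGL : ∀ᵐ μ ∂P, GlobalLayered (atoms μ)) {Hc F : Measure E3 → ℝ} (hHcm : Measurable Hc)
    (hFm : Measurable F) {K₀ : ℝ} (hHcK : ∀ μ, |Hc μ| ≤ K₀) (hF2 : ∀ μ, 0 ≤ F μ ∧ F μ ≤ 2)
    (hident : ∀ (S : Set E3) (e : LData), (0 : E3) ∈ S → (∀ x ∈ S, ∀ y ∈ S, x ≠ y → δ ≤ dist x y) →
      Fits S e → Hc ((Measure.count : Measure E3).restrict S) = inLayerInteraction lennardJones e.2.1 +
        (∑' m : ℤ, if m = 0 then (0 : ℝ) else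
          layerInteraction lennardJones e.2.1 (e.2.2.2 m) (haggLabel alternatingHagg m) 1) ∧
        F ((Measure.count : Measure E3).restrict S) =
          (if e.2.2.1 1 = -e.2.2.1 0 then (0 : ℝ) else 1) +
            (if e.2.2.1 (-2) = -e.2.2.1 (-1) then (0 : ℝ) else 1)) :
    ∀ᵐ μ ∂P, F μ = 0 := by
  obtain ⟨c, hc, hprice⟩ := lms_fault_price_ae_form
  obtain ⟨C, hC, hTB⟩ := lms_fault_transport_bound stub_windowLowerBound
  have hfit := lms_ae_fitted δ P hlaw.1 hGL
  set K : ℝ := max K₀ 2 with hKdef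
  have hK₀K : K₀ ≤ K := le_max_left _ _
  have h2K : (2 : ℝ) ≤ K := le_max_right _ _
  have hgnn : ∀ ν : Measure E3, 0 ≤ Hc ν + K := fun ν => by
    have := abs_le.1 ((hHcK ν).trans hK₀K)
    linarith [this.1]
  refine lms_faults_ae_zero δ hδ P hP hlaw Hc F hHcm hFm K c C hc hC
    (Eventually.of_forall fun μ => (hHcK μ).trans hK₀K)
    (Eventually.of_forall fun μ => ⟨(hF2 μ).1, (hF2 μ).2.trans h2K⟩) ?_ fun n => ?_
  · -- the price, almost surely
    filter_upwards [hfit] with μ hμ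
    obtain ⟨S, e, h0, hsep, he, rfl⟩ := hμ
    obtain ⟨h1, h2⟩ := hident S e h0 hsep he
    rw [h1, h2]
    exact hprice S e he
  · -- the uniform layer transport over the `2n+1` layers around the root
    obtain ⟨hU0, hUsym, hUsupp, hU1, hUavg⟩ := lms_uniformCoeff_props n
    obtain ⟨Ωr, Ωs, hΩrm, -, hKer⟩ := lms_exists_kernels δ hδ n
      (fun m => if m ∈ Finset.Icc (-(n : ℤ)) n then (1 : ℝ) / (2 * n + 1) else 0)
      hU0 hUsym hUsupp hU1 lms_layerRigid_of_not_fcc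
    refine ⟨Ωr, Ωs, hΩrm, ?_, ?_, ?_⟩
    · -- balance
      filter_upwards [hfit] with μ hμ
      obtain ⟨S, e, h0, hsep, he, rfl⟩ := hμ
      exact (hKer S e h0 hsep he).1
    · -- covariance
      filter_upwards [hfit] with μ hμ
      obtain ⟨S, e, h0, hsep, he, rfl⟩ := hμ
      intro y hy
      exact (hKer S e h0 hsep he).2.1 y ((count_restrict_singleton_ne_zero_iff S y).1 hy)
    · -- the transported competitor energy is at least `2e* − C/(2n+1)`
      filter_upwards [hfit] with μ hμ
      obtain ⟨S, e, h0, hsep, he, rfl⟩ := hμ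
      obtain ⟨-, -, hnf, hfc⟩ := hKer S e h0 hsep he
      by_cases hf : FccLike S
      · -- the ideal fcc lattice: trivial transport, competitor = hcp restacking
        have hfd : IsFccData e := lms_isFccData_of_fccLike S e hf he
        have hge := lms_competitor_ge_of_fcc e he.1 hfd
        have hHc := (hident S e h0 hsep he).1
        have hμ0 : (Measure.count : Measure E3).restrict S {(0 : E3)} = 1 := by
          rw [Measure.restrict_apply (measurableSet_singleton 0),
            inter_eq_left.2 (singleton_subset_iff.2 h0), Measure.count_singleton]
        have hdiv : 0 ≤ C / (2 * (n : ℝ) + 1) := by positivity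
        calc ENNReal.ofReal (2 * eStar - C / (2 * n + 1) + K)
            ≤ ENNReal.ofReal (Hc ((Measure.count : Measure E3).restrict S) + K) :=
              ENNReal.ofReal_le_ofReal (by rw [hHc]; linarith)
          _ = Ωs ((Measure.count : Measure E3).restrict S) 0 * ENNReal.ofReal
                (Hc (((Measure.count : Measure E3).restrict S).map (fun z => z - (0 : E3))) + K) := by
              rw [hfc hf 0, if_pos rfl, one_mul]
              simp only [sub_zero, Measure.map_id']
          _ = (Ωs ((Measure.count : Measure E3).restrict S) 0 * ENNReal.ofReal
                (Hc (((Measure.count : Measure E3).restrict S).map (fun z => z - (0 : E3))) + K)) *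
                (Measure.count : Measure E3).restrict S {(0 : E3)} := by rw [hμ0, mul_one]
          _ = ∫⁻ y in {(0 : E3)}, Ωs ((Measure.count : Measure E3).restrict S) y * ENNReal.ofReal
                (Hc (((Measure.count : Measure E3).restrict S).map (fun z => z - y)) + K)
                ∂((Measure.count : Measure E3).restrict S) :=
              (lintegral_singleton (μ := (Measure.count : Measure E3).restrict S)
                (fun y => Ωs ((Measure.count : Measure E3).restrict S) y * ENNReal.ofReal
                  (Hc (((Measure.count : Measure E3).restrict S).map (fun z => z - y)) + K))
                (0 : E3)).symm
          _ ≤ _ := setLIntegral_le_lintegral _ _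
      · -- off the fcc lattices: the explicit uniform transport and the window bound
        have hΩ : ∀ y : E3, Ωs ((Measure.count : Measure E3).restrict S) y =
            ENNReal.ofReal ((1 / (2 * (n : ℝ) + 1)) * ∑ m ∈ Finset.Icc (-(n : ℤ)) n,
              (if y ∈ layerTargets e m then (1 : ℝ) / (layerTargets e m).card else 0)) := by
          intro y
          rw [hnf hf y, ← hUavg]
        simp only [hΩ]
        refine hTB n S e he (fun y => Hc (((Measure.count : Measure E3).restrict S).map
          (fun z => z - y)) + K) K (fun y => hgnn _) fun m i j => ?_
        obtain ⟨h0', hsep', hfits', hmap⟩ := lms_reroot_sample δ S e h0 hsep he m i j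
        show Hc (((Measure.count : Measure E3).restrict S).map (fun z => z - pointOf e m i j)) + K = _
        rw [hmap, (hident _ _ h0' hsep' hfits').1]
        rfl

/-! ## Step 2: the registered sub-goal -/

/-- **Almost surely no stacking faults** (registered sub-goal `lms_ae_faultfree` of
`stub_layeredMeanSelection`): under a minimising law almost surely carried by globally layered
samples, almost surely every normal-form datum fitting the sample has an alternating stacking word,
`s (m+1) = −s m` for all `m`. [folklore] -/
theorem lms_ae_faultfree : ∀ (δ : ℝ), 0 < δ → ∀ (P : Measure (Measure E3)), IsProbabilityMeasure P → IsMinimisingLaw δ P → (∀ᵐ μ ∂P, GlobalLayered (atoms μ)) → ∀ᵐ μ ∂P, ∀ (S : Set E3) (e : LData), μ = (Measure.count : Measure E3).restrict S → (0 : E3) ∈ S → (∀ x ∈ S, ∀ y ∈ S, x ≠ y → δ ≤ dist x y) → Fits S e → ∀ m : ℤ, e.2.2.1 (m + 1) = -e.2.2.1 m := by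
  intro δ hδ P hP hlaw hGL
  obtain ⟨Hc, F, hHcm, hFm, K₀, hHcK, hF2, hident⟩ :=
    lms_exists_fault_functionals δ hδ lms_rel_of_fits
  -- Step 1: `F = 0` at the root, almost surely
  have hF0 : ∀ᵐ μ ∂P, F μ = 0 := faults_ae_zero_of_ident hδ hlaw hGL hHcm hFm hHcK hF2 hident
  -- Step 2: root-to-everywhere
  have hlf : ∀ᵐ μ ∂P, ∀ n : ℕ, μ ((fun z : E3 => ⌊‖z‖⌋₊) ⁻¹' {n}) < ⊤ := by
    filter_upwards [hlaw.1] with μ hcr n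
    obtain ⟨S, -, hsep, rfl⟩ := hcr
    exact PalmUnimodularRigidity.count_restrict_floorNorm_preimage_lt_top hδ hsep n
  have hF0' : ∀ᵐ μ ∂P, ∀ y : E3, μ {y} ≠ 0 → F (μ.map (fun z => z - y)) = 0 :=
    PalmUnimodularRigidity.ae_forall_map_sub_of_ae hlaw.2.1 hlf hF0
  -- Step 3: read off the word at every layer
  filter_upwards [hF0'] with μ hμ
  intro S e hμS h0 hsep he m
  subst hμS
  have hy : pointOf e m 0 0 ∈ S := by
    rw [← he.2]
    exact ⟨m, 0, 0, rfl⟩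
  have h1 := hμ (pointOf e m 0 0) ((count_restrict_singleton_ne_zero_iff S _).2 hy)
  obtain ⟨h0', hsep', hfits', hmap⟩ := lms_reroot_sample δ S e h0 hsep he m 0 0
  rw [hmap, (hident _ _ h0' hsep' hfits').2] at h1
  have key : (rerootData e m).2.2.1 1 = -(rerootData e m).2.2.1 0 := by
    by_contra hne
    rw [if_neg hne] at h1
    have : (0 : ℝ) ≤ (if (rerootData e m).2.2.1 (-2) = -(rerootData e m).2.2.1 (-1) then (0 : ℝ) else 1) := by
      split_ifs <;> norm_num
    linarith
  have key' : e.2.2.1 (1 + m) = -e.2.2.1 (0 + m) := key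
  rwa [add_comm, zero_add] at key'

end Summit.AtomisticToContinuum.Crystallization.Theorems.SlackRigidityPricedFloorsFinal

end
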